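import Summits.QuantumFields.YangMills.Theorems.BalabanUVNodesN09RegularityTowerOfLocalRouteAlphaFree
import Summits.QuantumFields.YangMills.Theorems.BalabanUVNodesN09BetaInputMeasurableOverTcan
import Literature.MathematicalPhysics.QuantumFieldTheory.Balaban1983to89.B12NodeKnitRecord13SepCoPH
import HarnessLib

/-!
# BalabanUVNodes ∕ N09 — ROAD B's RECORD TOWER AND DOOR WITH (H-U) AS ONE LETTER: `hρm` ((H-U)-measurability of the β-inputs) and `hint` ((I19) integrability) are theorems of
# `hU : ∀ k, Measurable (Uk K (k+1) εreg)`; at one radius `hsolν` is a theorem of the level-wise `h11`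

Cell `pub-ymgap`, width seat `pub-ymgap-dag-n09-w2` generation 5 (HUMAN RULING D-0149; DAG node N09 = [Balaban1987RG1] §§2–5; INBOX CLAIM-6∕INTENT-10).
`--kind proof --supports stmt-QuantumFields-27364 --as helper` (K1⁹ `StabilityBRunRowsAtRecordR13SepCoPHV`; count-neutral; theorems only, 0 def ∕ 0 instance ∕ 0 notation ∕ 0 sorry).

WHY.  This seat's road-B record tower ∕ door (`…N09RegularityTowerOfLocalRoute` p639613, α-free `…AlphaFree` p644086) display, per step, the measurability `hρm` of the β-input and its
integrability `hint` ((I19)), and the door displays [B11] solvability `hsolν` on the domains next to the level-wise `h11`.  Road A′'s doors (dag-n09-w5 g5 ∕ dag-n09-w4 g6) display instead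
the ONE (H-U) letter `hU : ∀ k, Measurable (Uk F N K (k+1) ν.εreg)` and derive (I19) (dag-n24-c's `integrable_betaInput_stage13_of_measurableUk`); `hρm` is likewise a theorem of `hU`
(dag-n09-w3 g6's `measurable_betaInput_TcanOfRecord_chi29_of`, K0's `integrable_betaInput_TcanOfRecord_chi29`); and at ONE radius (`εreg = εbg`) `hsolν` IS the existence half of `h11` one
level up.  So road B's record door reads the SAME non-numeric letter kinds as road A′'s: (181)ˢᵒˡ `hcov`, (H-U) `hU`, hcrit (here: the critical configurations CONTINUOUS ON the next domains),
the level-wise `h11`, `hres` — and numerics in `(εreg, ε₂₉, ε₀; d, L, N)`.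

WHAT IS PROVED (theorems only).
§1 ★★ `hreg_pos_all_of_localSupportSet_alphaFree_of_hU` (p644086 §1 with `hρm hint ↦ hU`).
§2 `hsolν_of_h11_of_εreg_eq` (bookkeeping), ★★★ `thm3Member_stage13SepCoPH_atDomAlt_of_localRoute_of_hU_of_numerics_of_εreg_eq_alphaFree` (p644086 §2's door with `hρm hint hsolν` GONE:
   displayed = `hC`, `0 < ε₂₉`, `εreg = εbg`, [B7] on `εreg`, `hn1 hn2`, (181)ˢᵒˡ `hcov`, (H-U) `hU`, on-domain hcrit, the three `ε₀`-lines, strict (hord), `0 ≤ ε₀`, `((dL)²∕4)·ε₀ < δ_Fed`,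
   level-wise `h11`, `hres`).

HONEST FRAMING.  Count-neutral re-keying BY NAME (three displayed hypotheses discharged by siblings' theorems); NOTHING of Bałaban's asserted; [B11] Thm 1 enters only as displayed hypotheses
(`h11`, `hres`); (H-U) is DISPLAYED (`hU`), not discharged; the on-domain hcrit has NO supplier for the bare `Classical.choose` background (the (2.3) re-point is def-T ∕ def-B's; road B is
letter-parametric by `…N09RegularityTowerAnyCritOfLocalRoute` p645251); N09 NOT discharged; conjunct 1 (Lemma 4) ∕ FLAG №7 untouched; K0⁷ ∕ K1⁹ ∕ K2⁹ ∕ K3⁸ NOT closed; counts unmoved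
(typed 28∕28 · discharged 5∕28); no summit statement is proved here; R4 = the conditional finite-𝕋⁴ rung `BalabanLadder.UV` only — NOT continuum ∕ ℝ⁴ ∕ OS; the Yang–Mills mass gap
(Clay) is NOT proved by any of this.
-/

noncomputable section

open Filter Topology Set Function MeasureTheory

namespace Summit.QuantumFields.YangMills.BalabanUVNodes.N09RegularityTowerOfLocalRouteOfHU

open Literature.MathematicalPhysics.QuantumFieldTheory.Balaban1983to89
open Literature.MathematicalPhysics.QuantumFieldTheory.Balaban1983to89.Node00
open Literature.MathematicalPhysics.QuantumFieldTheory.Balaban1983to89.T4Continuum (T4Family)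
open Literature.MathematicalPhysics.QuantumFieldTheory.Balaban1983to89.DagBinding (WorldP leavesP)
open Literature.MathematicalPhysics.QuantumFieldTheory.Balaban1983to89.B12RTGaugeInvariance254 (liftTransf)
open Literature.MathematicalPhysics.QuantumFieldTheory.Balaban1983to89.GaugeField (gaugeAct)
open Literature.MathematicalPhysics.QuantumFieldTheory.Balaban1983to89.ExpMeanLog (expMeanLogSU deltaSU)
open Literature.MathematicalPhysics.QuantumFieldTheory.Balaban1983to89.FederbushMean (deltaFed)
open Literature.MathematicalPhysics.QuantumFieldTheory.Balaban1983to89.B12NodeKnitRecord13SepCoPH (integrable_betaInput_stage13_of_measurableUk)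
open Summit.QuantumFields.YangMills.BalabanUVNodes.N09RegularityTowerOfLocalRouteAlphaFree
  (hreg_pos_all_of_localSupportSet_alphaFree thm3Member_stage13SepCoPH_atDomAlt_of_localRoute_of_numerics_of_εreg_eq_alphaFree)
open Summit.QuantumFields.YangMills.BalabanUVNodes.N09BetaInputMeasurableOverTcan (measurable_betaInput_TcanOfRecord_chi29_of)

variable {F : T4Family} {N : ℕ} [NeZero N]

/-! ## §1 The α-free record tower with (H-U) as one letter -/

section Tower

variable (θ₀ : Stage13Params F N) (K : ℕ) (g : ℕ → ℝ)

/-- ★★ **ROAD B's `hreg_j` ∧ (F3)_j FOR EVERY `j < K`, α-FREE, (H-U) AS ONE LETTER** (p644086's `hreg_pos_all_of_localSupportSet_alphaFree` with `hρm := measurable_betaInput_TcanOfRecord_chi29_of … hU`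
and `hint := integrable_betaInput_TcanOfRecord_chi29 … hU`). [cite: Balaban1987RG1, p.259, (0.19) p.255, (2.9) p.266 and (2.10) p.267] -/
theorem hreg_pos_all_of_localSupportSet_alphaFree_of_hU (hεreg : 0 < θ₀.ν.εreg)
    (hε3 : (143 * (((((F.P K).d + 4 : ℕ) : ℝ)) ^ 2 / 4) ^ 2) * θ₀.ν.εreg ≤ 1 / 3)
    (hε2 : 2 * θ₀.ν.εreg ≤ 2 * deltaSU (Fin N) / ((((F.P K).d + 4) * (F.P K).L : ℕ) : ℝ) ^ 2) (hε29 : 0 < θ₀.ε₂₉)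
    (hn1 : 1640 * (2 * (((((F.P K).d + 2) * (F.P K).L : ℕ) : ℝ) * θ₀.ε₂₉) +
        ((((F.P K).d + 2) * (F.P K).L : ℕ) : ℝ) ^ 2 / 4 * (2 * θ₀.ν.εreg / ((F.P K).L : ℝ) ^ 2)) * (((F.P K).L : ℝ) ^ ((F.P K).d - 1)) ^ 2 ≤ 1)
    (hn2 : 13 * (2 * (((((F.P K).d + 2) * (F.P K).L : ℕ) : ℝ) * θ₀.ε₂₉) +
        ((((F.P K).d + 2) * (F.P K).L : ℕ) : ℝ) ^ 2 / 4 * (2 * θ₀.ν.εreg / ((F.P K).L : ℝ) ^ 2)) * ((F.P K).L : ℝ) ^ ((F.P K).d - 1) < deltaSU (Fin N))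
    (h24 : ((((F.P K).d + 2) * (F.P K).L : ℕ) : ℝ) ^ 2 / 4 * θ₀.ν.ε₀ < 1 / 24)
    (h64 : 64 * (((((F.P K).d + 2) * (F.P K).L : ℕ) : ℝ) ^ 2 / 4 * θ₀.ν.ε₀) < deltaSU (Fin N))
    (hL : 157 * (((((F.P K).d + 2) * (F.P K).L : ℕ) : ℝ) ^ 2 / 4 * θ₀.ν.ε₀) < ((((F.P K).L : ℝ)) ^ ((F.P K).d - 1))⁻¹)
    (hord : 2 * θ₀.ν.εreg / ((F.P K).L : ℝ) ^ 2 +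
      4 * max θ₀.ε₂₉ (10 * (((((F.P K).d + 2) * (F.P K).L : ℕ) : ℝ) * θ₀.ε₂₉) * ((F.P K).L : ℝ) ^ ((F.P K).d - 1)) < θ₀.ν.ε₀)
    (hU : ∀ k, Measurable (Uk F N K (k + 1) θ₀.ν.εreg))
    (hsolν : ∀ j < K, ∀ W ∈ domAltOfRecord F N θ₀.ν K (j + 1), UkExists F N K (j + 1) θ₀.ν.εreg W)
    (hcrit : ∀ j < K, ContinuousOn (critCfgOfRecord F N θ₀.ν K j) (domAltOfRecord F N θ₀.ν K (j + 1)))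
    (hGF : ∀ j < K, ContinuousOn (gfOfRecord F N K j) (domAltOfRecord F N θ₀.ν K j)) :
    ∀ j < K, domAltOfRecord F N θ₀.ν K (j + 1) ⊆ regSetOfRecord F N K j (betaInputOfRecord F N (TcanOfRecord F N) (chiβOfRecord₁₃ F N θ₀) K g j) ∧
      ∀ V ∈ domAltOfRecord F N θ₀.ν K (j + 1), 0 < TcanOfRecord F N K j (betaInputOfRecord F N (TcanOfRecord F N) (chiβOfRecord₁₃ F N θ₀) K g j) V :=
  hreg_pos_all_of_localSupportSet_alphaFree θ₀ K g hεreg hε3 hε2 hε29 hn1 hn2 h24 h64 hL hord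
    (fun j _ => measurable_betaInput_TcanOfRecord_chi29_of θ₀.ν θ₀.ε₂₉ K g hU j)
    (fun _ hj => integrable_betaInput_TcanOfRecord_chi29 θ₀.ν θ₀.ε₂₉ K hU g hj.le) hsolν hcrit hGF

end Tower

/-! ## §2 The record door with (H-U) as one letter and `hsolν` read off `h11` -/

section Door

variable (θ : Stage13HParams F N) (h : θ.Provisos₁₃SepCoPH F N) {w : WorldP} (P : B12.RunParams)

/-- **At one radius (`εreg = εbg`) the doors' solvability binder `hsolν` on the next domains is the existence half of the level-wise `h11` one level up** (bookkeeping).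
[cite: Balaban1985Variational, Thm 1 p.279 (bookkeeping)] -/
theorem hsolν_of_h11_of_εreg_eq (heq : θ.toStage13Params.ν.εreg = θ.εbg)
    (h11 : ∀ k, k ≤ P.K → ∀ V ∈ domAltOfRecord F N θ.ν P.K k, UkExists F N P.K k θ.εbg V ∧ UniqueUkOrbit F N P.K k θ.εbg V) :
    ∀ j < P.K, ∀ W ∈ domAltOfRecord F N θ.ν P.K (j + 1), UkExists F N P.K (j + 1) θ.toStage13Params.ν.εreg W := by
  intro j hj W hW
  rw [heq]
  exact (h11 (j + 1) hj W hW).1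

/-- **★★★ N09's THEOREM-3 MEMBER AT THE STAGE-13 RECORD ON THE LOCAL ROUTE, α-FREE, `huniq`-FREE, (H-U) AS ONE LETTER, `hsolν` READ OFF `h11`** (p644086's
`thm3Member_stage13SepCoPH_atDomAlt_of_localRoute_of_numerics_of_εreg_eq_alphaFree` with `hρm := measurable_betaInput_TcanOfRecord_chi29_of … hU`, `hint := integrable_betaInput_stage13_of_measurableUk
… hU`, `hsolν := hsolν_of_h11_of_εreg_eq`).  Displayed N09-side inputs: (181)ˢᵒˡ `hcov`, (H-U) `hU`, the critical configurations CONTINUOUS ON the next domains (hcrit), the level-wise `h11`,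
`hres`; numerics in `(εreg, ε₂₉, ε₀; d, L, N)`.  CONDITIONAL; nothing of Bałaban's asserted; N09 NOT discharged.
[cite: Balaban1987RG1, Thm 3 p.264, p.259, (0.11) p.253, (0.17)–(0.19) p.255, (2.9) p.266, (2.10) p.267; Balaban1985Variational, Thm 1 (8)–(10) p.279 and (181) p.307] -/
theorem thm3Member_stage13SepCoPH_atDomAlt_of_localRoute_of_hU_of_numerics_of_εreg_eq_alphaFree
    (hC : w.C = (datumOfRecord₁₃SepCoPH F N θ h).C) (hε : 0 < θ.ε₂₉) (heq : θ.toStage13Params.ν.εreg = θ.εbg)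
    (hεreg : 0 < θ.toStage13Params.ν.εreg)
    (hε3 : (143 * (((((F.P P.K).d + 4 : ℕ) : ℝ)) ^ 2 / 4) ^ 2) * θ.toStage13Params.ν.εreg ≤ 1 / 3)
    (hε2 : 2 * θ.toStage13Params.ν.εreg ≤ 2 * deltaSU (Fin N) / ((((F.P P.K).d + 4) * (F.P P.K).L : ℕ) : ℝ) ^ 2)
    (hn1 : 1640 * (2 * (((((F.P P.K).d + 2) * (F.P P.K).L : ℕ) : ℝ) * θ.toStage13Params.ε₂₉) +
        ((((F.P P.K).d + 2) * (F.P P.K).L : ℕ) : ℝ) ^ 2 / 4 * (2 * θ.toStage13Params.ν.εreg / ((F.P P.K).L : ℝ) ^ 2)) *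
          (((F.P P.K).L : ℝ) ^ ((F.P P.K).d - 1)) ^ 2 ≤ 1)
    (hn2 : 13 * (2 * (((((F.P P.K).d + 2) * (F.P P.K).L : ℕ) : ℝ) * θ.toStage13Params.ε₂₉) +
        ((((F.P P.K).d + 2) * (F.P P.K).L : ℕ) : ℝ) ^ 2 / 4 * (2 * θ.toStage13Params.ν.εreg / ((F.P P.K).L : ℝ) ^ 2)) *
          ((F.P P.K).L : ℝ) ^ ((F.P P.K).d - 1) < deltaSU (Fin N))
    (hcov : ∀ j < P.K, ∀ (v : GaugeTransf (F.P P.K) (j + 1) (SU N)) (W : GaugeField (F.P P.K) (j + 1) (SU N)),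
      UkExists F N P.K (j + 1) θ.toStage13Params.ν.εreg W →
        critCfgOfRecord F N θ.toStage13Params.ν P.K j (gaugeAct v W) = gaugeAct (liftTransf v) (critCfgOfRecord F N θ.toStage13Params.ν P.K j W))
    (hU : ∀ k, Measurable (Uk F N P.K (k + 1) θ.toStage13Params.ν.εreg))
    (hcrit : ∀ j < P.K, ContinuousOn (critCfgOfRecord F N θ.toStage13Params.ν P.K j) (domAltOfRecord F N θ.ν P.K (j + 1)))
    (h24 : ((((F.P P.K).d + 2) * (F.P P.K).L : ℕ) : ℝ) ^ 2 / 4 * θ.toStage13Params.ν.ε₀ < 1 / 24)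
    (h64 : 64 * (((((F.P P.K).d + 2) * (F.P P.K).L : ℕ) : ℝ) ^ 2 / 4 * θ.toStage13Params.ν.ε₀) < deltaSU (Fin N))
    (hL : 157 * (((((F.P P.K).d + 2) * (F.P P.K).L : ℕ) : ℝ) ^ 2 / 4 * θ.toStage13Params.ν.ε₀) < ((((F.P P.K).L : ℝ)) ^ ((F.P P.K).d - 1))⁻¹)
    (hord' : 2 * θ.toStage13Params.ν.εreg / ((F.P P.K).L : ℝ) ^ 2 +
      4 * max θ.toStage13Params.ε₂₉ (10 * (((((F.P P.K).d + 2) * (F.P P.K).L : ℕ) : ℝ) * θ.toStage13Params.ε₂₉) * ((F.P P.K).L : ℝ) ^ ((F.P P.K).d - 1)) <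
        θ.toStage13Params.ν.ε₀)
    (hε₀ : 0 ≤ θ.toStage13Params.ν.ε₀) (hfed : ((((F.P P.K).d * (F.P P.K).L : ℕ) : ℝ)) ^ 2 / 4 * θ.toStage13Params.ν.ε₀ < deltaFed (Fin N))
    (h11 : ∀ k, k ≤ P.K → ∀ V ∈ domAltOfRecord F N θ.ν P.K k, UkExists F N P.K k θ.εbg V ∧ UniqueUkOrbit F N P.K k θ.εbg V)
    (hres : ∀ k, k ≤ P.K → HRestrict F N θ.εbg P.K k (domAltOfRecord F N θ.ν P.K k)) :
    (leavesP w P).smallCouplings → (leavesP w P).smallFieldInductive :=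
  thm3Member_stage13SepCoPH_atDomAlt_of_localRoute_of_numerics_of_εreg_eq_alphaFree θ h P hC hε heq hεreg hε3 hε2 hn1 hn2 hcov (hsolν_of_h11_of_εreg_eq θ P heq h11)
    (integrable_betaInput_stage13_of_measurableUk θ.toStage13Params P fun k _ => hU k)
    (fun j _ => measurable_betaInput_TcanOfRecord_chi29_of θ.toStage13Params.ν θ.toStage13Params.ε₂₉ P.K (gOfRecord₁₃ F N θ.toStage13Params P) hU j)
    hcrit h24 h64 hL hord' hε₀ hfed h11 hres

end Door

end Summit.QuantumFields.YangMills.BalabanUVNodes.N09RegularityTowerOfLocalRouteOfHU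

end
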